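import Summits.BirchSwinnertonDyer.BirchSwinnertonDyer.Theorems.UniversalToricDescentThinCombRatCombTightness
import HarnessLib

/-!
# utd-idea g63 — pencil audit of crux 24207 (`RationalSplitIMCInclusionAtThree`)

Two typed SUPPORT-grade statements isolating what the weak-reflection input K4 ⊕ K3(iii) of line
`ratwall_thin_comb` buys in the rigidity step, over the crux's ring `Λ₂(R₀) = R₀⟦T₂⟧⟦T₁⟧`, `R₀ = unrIntegers 3`.

* `OneCombVisibleRigidity` — ONE rational comb plus `G ∉ (3, T₂)` (⟺ `μ(G(T₁,0)) = 0`, the bottom-line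
  μ-invariant) already gives INTEGRAL two-variable divisibility `G ∣ F`, with no reflection at all: the only primes a
  T₂-comb cannot see are the `q` with `q ≡ T₂^b · unit (mod 3)`, `b ≥ 1`, and those lie in `(3, T₂)`.
* `TwoPencilRigidity` — comb divisibility for `(G, F)` AND for the swapped pair `(σG, σF)` gives `G ∣ 3^a F`
  with NO self-symmetry hypothesis on `G` or `F` (strictly weaker hypotheses than `dvd_pow_mul_of_weakReflection`
  for `ρ = σ`; proof on paper: an excess prime `q` of `G` has finitely many common zeros with `F/q^{e'}` in the open
  bidisc (height count in the 3-dimensional regular ring `Λ₂`), so `λ(q mod E_m(T₂)) = 0` on almost all levels, which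
  forces `q ≡ T₂^{b} u (mod 3)`; the swapped comb forces `q ≡ T₁^{b'} u' (mod 3)`; hence `q` is a unit).

Both survive the tree's tightness witnesses `(G, F) = (T₂, 1)` and `(T₂T₁, T₁)`
(`not_rigid_without_G_symmetry_unr`, `not_rigid_without_F_symmetry_unr`): see the `witness_*` lemmas below.
Nothing here is a crux; these are memo Props (LENS-MEMO-utd-idea-g63 §3).
-/

noncomputable section

open Literature.NumberTheory.EllipticCurves
open Summit.BirchSwinnertonDyer.BirchSwinnertonDyer.Theorems.UniversalToricDescentThinComb

namespace Summit.BirchSwinnertonDyer.BirchSwinnertonDyer.Cruxes.RationalSplitIMCInclusionAtThree.PencilAudit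

instance : Fact (Nat.Prime 3) := ⟨Nat.prime_three⟩

/-- The crux's coefficient ring `R₀ = 𝒪_{ℚ₃^{ur}}^∧ ⊂ ℂ₃` as a type. -/
abbrev R₀ : Type := unrIntegers 3

/-- The ideal `(3, T₂) ⊂ Λ₂(R₀)`: `G ∉ (3, T₂)` iff `G(T₁, 0) ≢ 0 (mod 3)` iff the bottom-line μ-invariant of `G`
vanishes (and `G(T₁,0) ≠ 0`). -/
def bottomIdeal : Ideal (PowerSeries (PowerSeries R₀)) :=
  Ideal.span {const R₀ (((3 : ℕ) : ℕ) : R₀), T₂ R₀}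

/-- **P1 (support candidate).** One rational T₂-comb + `G ∉ (3, T₂)` ⇒ `G ∣ F` integrally. -/
def OneCombVisibleRigidity : Prop :=
  ∀ G F : PowerSeries (PowerSeries R₀), G ∉ bottomIdeal → ThinCombDvdRat R₀ 3 G F → G ∣ F

/-- **P2 (support candidate).** Two pencils (the comb for `(G,F)` and for the swapped pair) ⇒ `G ∣ 3^a F`,
with no self-symmetry of `G` or `F`. -/
def TwoPencilRigidity : Prop :=
  ∀ G F : PowerSeries (PowerSeries R₀), ThinCombDvdRat R₀ 3 G F →
    ThinCombDvdRat R₀ 3 (IntSeries.transposeRingEquiv R₀ G) (IntSeries.transposeRingEquiv R₀ F) →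
      ∃ a : ℕ, G ∣ const R₀ ((((3 : ℕ) : ℕ) : R₀) ^ a) * F

/-! ## Falsifier pass: the tree's two tightness witnesses are excluded by the new hypotheses -/

/-- Witness 1 of the tree (`G = T₂`, `F = 1`) violates P1's hypothesis: `T₂ ∈ (3, T₂)`. -/
theorem witness₁_mem_bottomIdeal : T₂ R₀ ∈ bottomIdeal :=
  Ideal.subset_span (by simp)

/-- Witness 2 of the tree (`G = T₂·T₁`, `F = T₁`) violates P1's hypothesis: `T₂·T₁ ∈ (3, T₂)`. -/
theorem witness₂_mem_bottomIdeal : T₂ R₀ * T₁ R₀ ∈ bottomIdeal :=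
  Ideal.mul_mem_right _ _ witness₁_mem_bottomIdeal

/-- The swap sends witness 1 to the pair `(T₁, 1)`. -/
theorem transpose_witness₁ :
    IntSeries.transposeRingEquiv R₀ (T₂ R₀) = T₁ R₀ ∧ IntSeries.transposeRingEquiv R₀ (1 : PowerSeries (PowerSeries R₀)) = 1 :=
  ⟨RatCombTightness.transpose_T₂ R₀, map_one _⟩

/-- `3^t ∉ (T₁, E_m(T₂))`: the quotient by `(T₁, E_m(T₂))` is the level ring `R₀[ζ_{3^{m+1}}]`, where no power of `3`
vanishes — so the swapped witness-1 pair `(T₁, 1)` has NO rational comb divisibility and P2's second hypothesis fails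
on witness 1 (consistency of P2 with `not_rigid_without_G_symmetry_unr`). Stated as a Prop; the proof is the
level-ring computation of `RatCombTightness.T₂_not_dvd_const` transported by `σ`. -/
def SwappedWitness₁NoComb : Prop :=
  ¬ ThinCombDvdRat R₀ 3 (T₁ R₀) 1

/-- P2's hypotheses are implied by those of the tree's swap-rigidity theorem whenever comb divisibility is invariant
under passing to associates (which it is: units restrict to units on every level) — recorded as the typed reduction
shape the memo claims; no proof attempted here. -/
def TwoPencilDominatesSwapRigidity : Prop :=
  TwoPencilRigidity →
    ∀ G F : PowerSeries (PowerSeries R₀),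
      Associated (IntSeries.transposeRingEquiv R₀ G) G → Associated (IntSeries.transposeRingEquiv R₀ F) F →
        ThinCombDvdRat R₀ 3 G F → ∃ a : ℕ, G ∣ const R₀ ((((3 : ℕ) : ℕ) : R₀) ^ a) * F

/-- Comb divisibility is invariant under replacing `F` by an associate (the easy half of the reduction above). -/
theorem thinCombDvdRat_of_associated_right {G F F' : PowerSeries (PowerSeries R₀)} (hF : Associated F F')
    (h : ThinCombDvdRat R₀ 3 G F) : ThinCombDvdRat R₀ 3 G F' := by
  intro n
  obtain ⟨m, hnm, t, hmem⟩ := h n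
  obtain ⟨u, hu⟩ := hF
  refine ⟨m, hnm, t, ?_⟩
  have : const R₀ ((((3 : ℕ) : ℕ) : R₀) ^ t) * F' = (const R₀ ((((3 : ℕ) : ℕ) : R₀) ^ t) * F) * ↑u := by
    rw [← hu]; ring
  rw [this]
  exact Ideal.mul_mem_right _ _ hmem

/-- Comb divisibility is invariant under replacing `G` by an associate. -/
theorem thinCombDvdRat_of_associated_left {G G' F : PowerSeries (PowerSeries R₀)} (hG : Associated G G')
    (h : ThinCombDvdRat R₀ 3 G F) : ThinCombDvdRat R₀ 3 G' F := by
  intro n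
  obtain ⟨m, hnm, t, hmem⟩ := h n
  refine ⟨m, hnm, t, ?_⟩
  have hspan : Ideal.span ({G, combElt R₀ 3 m} : Set (PowerSeries (PowerSeries R₀))) =
      Ideal.span {G', combElt R₀ 3 m} := by
    obtain ⟨u, hu⟩ := hG
    apply le_antisymm
    · rw [Ideal.span_le]
      rintro x hx
      rcases hx with rfl | rfl
      · have : x = G' * ↑u⁻¹ := by rw [← hu]; simp [mul_assoc]
        rw [this]
        exact Ideal.mul_mem_right _ _ (Ideal.subset_span (by simp))
      · exact Ideal.subset_span (by simp)
    · rw [Ideal.span_le]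
      rintro x hx
      rcases hx with rfl | rfl
      · rw [← hu]
        exact Ideal.mul_mem_right _ _ (Ideal.subset_span (by simp))
      · exact Ideal.subset_span (by simp)
  rw [← hspan]
  exact hmem

/-- **The reduction holds**: P2 implies the swap case of the tree's weak-reflection rigidity. -/
theorem twoPencilDominatesSwapRigidity : TwoPencilDominatesSwapRigidity := by
  intro h2 G F hG hF hcomb
  refine h2 G F hcomb ?_
  exact thinCombDvdRat_of_associated_right hF.symm (thinCombDvdRat_of_associated_left hG.symm hcomb)


end Summit.BirchSwinnertonDyer.BirchSwinnertonDyer.Cruxes.RationalSplitIMCInclusionAtThree.PencilAudit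

end
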